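import Summits.QuantumFields.BalabanUV.T4Continuum.Support.NE7K1LinBilinConjError
import Summits.QuantumFields.BalabanUV.T4Continuum.Support.NE7K1LinFineOpWeight

/-!
# NE7K1LinFineOpBilinWeight — row NE7 (node U5), candidate route HOM, path H1L, cell K1-lin(s): (π6)(ii) for the FINITE-RANGE
# member — the BILINEAR conjugation error of Bałaban's `A = 0` operator `fineOpR n a 0 R` at a general weight is bounded
# FORM-RELATIVELY and `η`-FREE: `|⟨z,(e^{φ}P₀e^{−φ} − P₀)u⟩| ≤ √(2κ)(‖z‖√⟨u,P₀u⟩ + ‖u‖√⟨z,P₀z⟩) + (κ + a(e^Θ−1))‖z‖‖u‖`,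
# `κ = 2(d+1)δ′²`

Lineage `b2b-balaban-t4-ne7-p2` (CRUX PROVER NE7 #2), generation 64; companion of `NE7K1LinFineOpWeight` (the QUADRATIC error) and
the `P₀`-member input (`hb₀`) of `NE7K1LinSchurLineDerivRelW.inv_line_sub_inv_line_weighted`.  Across a bond the weight oscillates by
`≤ δ′η`, the coupling is `η⁻²`, so `c·sinh² ≲ δ′²` per bond while `c·(u_k − u_j)²` is the Dirichlet density — the first-order
term is `η`-free RELATIVE TO THE FORM (abstract part: `NE7K1LinBilinConjError`).  [folklore]:
* `dirichlet_le_fineOpR_form`: `⟨v, lap(adjC) v⟩ ≤ ⟨v, fineOpR n a 0 R v⟩` (block term `≥ 0`);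
* **`bilin_conjError_fineOpR_le`**: for `n ≥ 1`, `R` a union of `n`-blocks, `a ≥ 0`, `|φ x − φ y| ≤ δ′∕n ≤ 1` across bonds and
  `≤ Θ` (`Θ ≥ 0`) inside blocks, all `z, u`: the displayed bound, `P₀ = fineOpR n a 0 R`, `‖v‖ = √(v ⬝ᵥ v)` — the shape of `hb₀`
  with `κ_{(π6)} = √(2κ) + κ + a(e^Θ−1)`.
What remains for the U = 1 instance of (π6): the Schur member `P₁ = S(H_B)` (harmonic extensions `⟨Ez, H E_ρu⟩ = ⟨z,P₁u⟩`).

HONEST FRAMING: [folklore] over the tree's `B4Lower18`; nothing printed asserted; no `sorry`.  FIXED FINITE T⁴, rung (B)+1; NE7 NOT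
PRINTED ∕ NOT PROVED; spine 0∕9; NOT infinite volume, NOT mass gap, NOT Clay.  HONEST DEPENDENCY: continuum YM on T⁴ ⇐ BetaPertH ∧
nine spine estimates (0/9 proved); BetaPertH ⇐ (D1) ∧ (D4) ∧ CAP+tail; G-an2-4 gates asym, D1 and NE2/3/4.
-/

noncomputable section

open Finset Matrix

namespace Summit.QuantumFields.BalabanUV.T4Continuum.NE7K1LinFineOpBilinWeight

open Literature.MathematicalPhysics.QuantumFieldTheory.Balaban1983to89
open Literature.MathematicalPhysics.QuantumFieldTheory.Balaban1983to89.B4Reflection242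
open Literature.MathematicalPhysics.QuantumFieldTheory.Balaban1983to89.B4Lower18
open Literature.MathematicalPhysics.QuantumFieldTheory.Balaban1983to89.Beta.CombesThomasForm (lap lap_apply lap_form lapDefect_le
  abs_exp_sub_one_le)
open NE7K1LinConjW NE7K1LinBilinConjError

/-! ### §2 The `A = 0` operator `fineOpR n a 0 R` -/

section FineOp

variable {d : ℕ}

/-- the Dirichlet part is below the full form: `⟨v, lap(adjC) v⟩ ≤ ⟨v, fineOpR n a 0 R v⟩` (`a ≥ 0`). [folklore] -/
theorem dirichlet_le_fineOpR_form {n : ℕ} (hn : 1 ≤ n) {R : Finset (Fin (d + 1) → ℤ)} (hR : IsBlockUnion n R)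
    {a : ℝ} (ha : 0 ≤ a) (v : ↥R → ℝ) :
    v ⬝ᵥ (lap (adjC n R)).mulVec v ≤ v ⬝ᵥ (fineOpR n a 0 R).mulVec v := by
  classical
  rw [lap_form _ (adjC_symm n R), fineOpR_form hn hR a 0 v, zero_mul, add_zero]
  have h1 : ∑ x : ↥R, ∑ y : ↥R, adjC n R x y * (v x - v y) ^ 2 =
      (n : ℝ) ^ 2 * ∑ x : ↥R, ∑ y : ↥R, (if y.1 ∈ nbrs x.1 then (v x - v y) ^ 2 else 0) := by
    rw [Finset.mul_sum]
    refine Finset.sum_congr rfl fun x _ => ?_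
    rw [Finset.mul_sum]
    refine Finset.sum_congr rfl fun y _ => ?_
    unfold adjC
    split_ifs <;> ring
  rw [h1]
  have h2 : 0 ≤ ∑ b : ↥(R.image (blk n)), (∑ x ∈ Finset.univ.filter (fun x => rblk n R x = b), v x) ^ 2 :=
    Finset.sum_nonneg fun _ _ => sq_nonneg _
  have h3 : 0 ≤ a * ((n : ℝ) ^ (d + 1))⁻¹ := by positivity
  nlinarith [mul_nonneg h3 h2]

/-- **THE BILINEAR CONJUGATION ERROR OF `fineOpR n a 0 R`, FORM-RELATIVE AND `η`-FREE** ((π6)(ii) for the finite-range member):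
for `n ≥ 1`, `R` a union of `n`-blocks, `a ≥ 0`, a weight `φ` with `|φ x − φ y| ≤ δ′∕n ≤ 1` across bonds and `≤ Θ` (`Θ ≥ 0`)
inside blocks, and all `z, u`: `|⟨z,(conjW φ P₀)u⟩ − ⟨z,P₀u⟩| ≤ √(2κ)·(‖z‖√⟨u,P₀u⟩ + ‖u‖√⟨z,P₀z⟩) + (κ + a(e^Θ−1))·‖z‖‖u‖`,
`κ = 2(d+1)δ′²`, `‖v‖ = √(v ⬝ᵥ v)`. [folklore] -/
theorem bilin_conjError_fineOpR_le {n : ℕ} (hn : 1 ≤ n) {R : Finset (Fin (d + 1) → ℤ)} (hR : IsBlockUnion n R)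
    {a δ' Θ : ℝ} (ha : 0 ≤ a) (hδ1 : δ' * (1 / (n : ℝ)) ≤ 1) (hΘ0 : 0 ≤ Θ) (φ : ↥R → ℝ)
    (hbond : ∀ x y : ↥R, y.1 ∈ nbrs x.1 → |φ x - φ y| ≤ δ' * (1 / (n : ℝ)))
    (hblock : ∀ x y : ↥R, blk n x.1 = blk n y.1 → |φ x - φ y| ≤ Θ) (z u : ↥R → ℝ) :
    |z ⬝ᵥ (conjW φ (fineOpR n a 0 R)).mulVec u - z ⬝ᵥ (fineOpR n a 0 R).mulVec u| ≤
      Real.sqrt (2 * (2 * ((d : ℝ) + 1) * δ' ^ 2)) *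
          (Real.sqrt (z ⬝ᵥ z) * Real.sqrt (u ⬝ᵥ (fineOpR n a 0 R).mulVec u) +
            Real.sqrt (u ⬝ᵥ u) * Real.sqrt (z ⬝ᵥ (fineOpR n a 0 R).mulVec z)) +
        (2 * ((d : ℝ) + 1) * δ' ^ 2 + a * (Real.exp Θ - 1)) * (Real.sqrt (z ⬝ᵥ z) * Real.sqrt (u ⬝ᵥ u)) := by
  classical
  have hn0 : (0 : ℝ) < n := by exact_mod_cast hn
  have hη : (0 : ℝ) < 1 / (n : ℝ) := by positivity
  -- the operator as `lap(adjC) + block term`, and the error splits accordingly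
  set Bm : Matrix ↥R ↥R ℝ := Matrix.of (fun x y : ↥R => ∑ b, a / ((Finset.univ.filter fun i => rblk n R i = b).card : ℝ)
    * ((if rblk n R x = b then (1 : ℝ) else 0) * (if rblk n R y = b then (1 : ℝ) else 0))) with hBm
  have hP : fineOpR n a 0 R = lap (adjC n R) + Bm := fineOpR_zero_eq_add hn hR a
  have herr : z ⬝ᵥ (conjW φ (fineOpR n a 0 R)).mulVec u - z ⬝ᵥ (fineOpR n a 0 R).mulVec u =
      (z ⬝ᵥ (conjW φ (lap (adjC n R))).mulVec u - z ⬝ᵥ (lap (adjC n R)).mulVec u) +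
        (z ⬝ᵥ (conjW φ Bm).mulVec u - z ⬝ᵥ Bm.mulVec u) := by
    rw [hP, conjW_add, add_mulVec, add_mulVec, dotProduct_add, dotProduct_add]; ring
  -- Laplacian member
  have hc : ∀ j k : ↥R, adjC n R j k ≠ 0 → adjC n R j k = ((1 / (n : ℝ)) ^ 2)⁻¹ ∧ |φ j - φ k| ≤ δ' * (1 / (n : ℝ)) := by
    intro j k hjk
    have hadj : k.1 ∈ nbrs j.1 := by
      by_contra h
      exact hjk (if_neg h)
    refine ⟨?_, hbond j k hadj⟩
    simp only [adjC, hadj, if_true]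
    field_simp
  have hκrow : ∀ j : ↥R, ∑ k, adjC n R j k * (Real.cosh (φ j - φ k) - 1) ≤ 2 * ((d : ℝ) + 1) * δ' ^ 2 := fun j =>
    lapDefect_le (adjC n R) φ hη hδ1 hc (fun j => card_filter_adjC_ne_zero_le n R j) j
  have hsmall : ∀ j k : ↥R, adjC n R j k ≠ 0 → |φ j - φ k| ≤ 1 := fun j k h => ((hc j k h).2).trans hδ1
  have hκ0 : 0 ≤ 2 * ((d : ℝ) + 1) * δ' ^ 2 := by positivity
  have hlap := bilin_conjError_lap_le (adjC n R) (adjC_symm n R) (adjC_nonneg n R) φ hκ0 hκrow hsmall z u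
  -- block member: `Bm j k = if rblk k = rblk j then a/|b| else 0`
  have hBm_apply : ∀ j k : ↥R, Bm j k = if rblk n R k = rblk n R j then
      a / ((Finset.univ.filter fun i => rblk n R i = rblk n R j).card : ℝ) else 0 := by
    intro j k
    simp only [hBm, Matrix.of_apply]
    rw [sum_ind_mul_ind]
  have hblk' : ∀ j k : ↥R, rblk n R j = rblk n R k → |φ j - φ k| ≤ Θ := fun j k hjk => hblock j k (congrArg Subtype.val hjk)
  have hmass : ∀ b : ↥(R.image (blk n)), a / ((Finset.univ.filter fun i => rblk n R i = b).card : ℝ) *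
      ((Finset.univ.filter fun j => rblk n R j = b).card : ℝ) ≤ a := by
    intro b
    rw [card_filter_rblk hn hR b]
    push_cast
    rw [div_mul_cancel₀ a (by positivity)]
  have hblocks := bilin_conjError_blocks_le (rblk n R) (fun b => a / ((Finset.univ.filter fun i => rblk n R i = b).card : ℝ))
    (fun b => div_nonneg ha (Nat.cast_nonneg _)) ha hmass φ hΘ0 hblk' z u
  have hBerr : z ⬝ᵥ (conjW φ Bm).mulVec u - z ⬝ᵥ Bm.mulVec u =
      ∑ j, ∑ k, (Real.exp (φ j - φ k) - 1) *
        (if rblk n R k = rblk n R j then a / ((Finset.univ.filter fun i => rblk n R i = rblk n R j).card : ℝ) else 0) *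
          (z j * u k) := by
    rw [bilin_conjW_sub_eq]
    exact Finset.sum_congr rfl fun j _ => Finset.sum_congr rfl fun k _ => by rw [hBm_apply]
  -- Dirichlet energies below the full energies
  have hDu := Real.sqrt_le_sqrt (dirichlet_le_fineOpR_form hn hR ha u)
  have hDz := Real.sqrt_le_sqrt (dirichlet_le_fineOpR_form hn hR ha z)
  have s1 := Real.sqrt_nonneg (z ⬝ᵥ z)
  have s2 := Real.sqrt_nonneg (u ⬝ᵥ u)
  have s3 := Real.sqrt_nonneg (2 * (2 * ((d : ℝ) + 1) * δ' ^ 2))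
  rw [herr]
  refine (abs_add_le _ _).trans ?_
  rw [hBerr]
  have hlap' : |z ⬝ᵥ (conjW φ (lap (adjC n R))).mulVec u - z ⬝ᵥ (lap (adjC n R)).mulVec u| ≤
      Real.sqrt (2 * (2 * ((d : ℝ) + 1) * δ' ^ 2)) *
          (Real.sqrt (z ⬝ᵥ z) * Real.sqrt (u ⬝ᵥ (fineOpR n a 0 R).mulVec u) +
            Real.sqrt (u ⬝ᵥ u) * Real.sqrt (z ⬝ᵥ (fineOpR n a 0 R).mulVec z)) +
        2 * ((d : ℝ) + 1) * δ' ^ 2 * (Real.sqrt (z ⬝ᵥ z) * Real.sqrt (u ⬝ᵥ u)) := by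
    refine hlap.trans (add_le_add (mul_le_mul_of_nonneg_left (add_le_add (mul_le_mul_of_nonneg_left hDu s1)
      (mul_le_mul_of_nonneg_left hDz s2)) s3) le_rfl)
  have hsum := add_le_add hlap' hblocks
  refine hsum.trans (le_of_eq ?_)
  ring

end FineOp


end Summit.QuantumFields.BalabanUV.T4Continuum.NE7K1LinFineOpBilinWeight
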